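import Summits.CriticalPhenomena.PercolationContinuityZ3.Theorems.PercNearOneGluingNoHeavyLowerTailSahiAllButTwoDict
import Summits.CriticalPhenomena.PercolationContinuityZ3.Theorems.PercNearOneGluingNoHeavyLowerTailSahiCTCN2Monotone

/-!
# `NoHeavyLowerTail` (crux stmt-CriticalPhenomena-4575), Sahi / Kahn positivity: the ALL-BUT-TWO slot (II) — the certificate
# `ρ₂ = μ(· | exactly two closed)` is a reduced transport certificate as soon as `Ñ₂ ≥ 0` at the odds vector

Support file (cell `prim-l12`, seat P3, gen 20; `--supports stmt-CriticalPhenomena-4575`).  No `sorry`, no named facts, standard axioms.  Memo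
`run/shared/lean/prim/prim-l12/FROM-prim-l12-p3-g20-*.md`.

**THEOREM `rhoCert_allButTwo`.**  Let `k ≥ 2` and `q` interior.  If (a) `Θ(r)·D(r) ≤ (Π(r)+D(r))·e₂(r)` and (TC) `Ñ₂(K_𝒳, K_𝒵)(r) ≥ 0` for all
nonempty up-sets `𝒳, 𝒵` of patterns (`K_𝒴` the closed-set complex, `…SahiAllButTwoDict`), then `ρ₂ = μ(· | exactly two closed)` is a reduced
transport certificate (`…SahiTransportRho.RhoCert`) of the all-but-two pattern event `H = Th_{k−2}^k`; hence (`sahiE_three_nonneg_of_allButTwo`)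
`E₃(1_H, 1_U, 1_V) ≥ 0` for all increasing `U, V` in every dimension.  Row (o) is weighted LYM (`coeff_lymEdges_sub_nonneg`:
`e₂·t_K ≤ D·E_K` coefficientwise for every down-set `K`); row (TC) is EXACTLY `Ñ₂ ≥ 0` after clearing denominators (`tc_of_N2`): this is the
probabilistic identification behind the whole coefficientwise-threshold-certificate programme (memo g9 §1), now formal for `c = 2`.
With `…SahiCTCN2Five.eval_N2gen_nonneg_fin5` (Ñ₂ ∈ ℕ[r] on five points) this yields Kahn's Conjecture 5 / Sahi's `C₃` for the MAJORITY-OF-FIVE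
first slot (`…SahiAllButTwoFive`).  Nothing is asserted about the crux.
-/

noncomputable section

open scoped Classical

namespace Summit.CriticalPhenomena.PercolationContinuityZ3.Theorems

namespace SahiAllButTwo

open Finset MvPolynomial
open SahiHittingSlot SahiTransportCert SahiAllButOne SahiCTCForms SahiCTCGenFun
open Literature.Combinatorics.Sahi2008
open Literature.Probability.Percolation (DeterminedBy determinedBy_iff)
open Literature.Probability.Percolation.DecisionTree (ind ind_of_mem ind_of_not_mem ind_nonneg)

variable {k : ℕ} (q : Fin k → unitInterval)

/-- **The certificate** `ρ₂ = μ(· | exactly two coordinates closed)`. [this work] -/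
def rho2 (T : Set (Fin k)) : ℝ := if T ∈ exTwo k then bernoulliWeight q T / pr q (exTwo k) else 0

/-- `Σ_T ρ₂(T)·1_𝒴(T) = w({=2} ∩ 𝒴)/w({=2})`. [this work] -/
theorem sum_rho2_ind (𝒴 : Set (Set (Fin k))) : ∑ T, rho2 q T * ind 𝒴 T = pr q (exTwo k ∩ 𝒴) / pr q (exTwo k) := by
  rw [pr_inter_eq_sum, sum_div]
  refine sum_congr rfl fun T _ => ?_
  unfold rho2
  by_cases hT : T ∈ exTwo k
  · rw [if_pos hT, ind_of_mem hT]; ring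
  · rw [if_neg hT, ind_of_not_mem hT]; ring

/-! ### Row (o): the LYM inequality `e₂·t_K ≤ D·E_K` -/

/-- `E_K`: the common edges of `K` with itself are its 2-faces. [this work] -/
theorem commonEdges_self (K : Finset (Finset (Fin k))) : commonEdges K K = univ.powerset.filter fun S => #S = 2 ∧ S ∈ K := by
  ext S; simp only [commonEdges, mem_filter, and_self]

/-- **Weighted LYM for the (o) row**: for a down-set `K`, `D·E_K − e₂·t_K ∈ ℕ[r]`. [this work] -/
theorem coeff_lymEdges_sub_nonneg {K : Finset (Finset (Fin k))} (hK : IsLowerSet (K : Set (Finset (Fin k)))) (n : Fin k →₀ ℕ) :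
    0 ≤ (Dd * gf (commonEdges K K) - ee 2 * gf (bigFaces K) : MvPolynomial (Fin k) ℤ).coeff n := by
  have hKV : ∀ S ∈ K, S ⊆ (univ : Finset (Fin k)) := fun S _ => subset_univ S
  have hVV : ∀ S ∈ (univ : Finset (Fin k)).powerset, S ⊆ (univ : Finset (Fin k)) := fun S _ => subset_univ S
  set R := range (#(univ : Finset (Fin k)) + 1) with hR
  have e1 : (Dd : MvPolynomial (Fin k) ℤ) = ∑ j ∈ R.filter (fun j => 3 ≤ j), gf (univ.powerset.filter fun P : Finset (Fin k) => #P = j) := by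
    unfold Dd bySize; exact gf_filter_card_eq_sum hVV (fun j => 3 ≤ j)
  have e2 : gf (commonEdges K K) = gf (K.filter fun S => #S = 2) := by
    rw [commonEdges_self]; congr 1; ext S; simp only [mem_filter, mem_powerset, subset_univ, true_and]; tauto
  have e3 : (ee 2 : MvPolynomial (Fin k) ℤ) = gf (univ.powerset.filter fun P : Finset (Fin k) => #P = 2) := rfl
  have e4 : gf (bigFaces K) = ∑ j ∈ R.filter (fun j => 3 ≤ j), gf (K.filter fun S => #S = j) := by
    rw [bigFaces_eq_filter]; exact gf_filter_card_eq_sum hKV (fun j => 3 ≤ j)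
  rw [e1, e2, e3, e4, sum_mul, mul_sum, ← sum_sub_distrib, coeff_sum]
  refine sum_nonneg fun j hj => ?_
  have hj2 := (mem_filter.1 hj).2
  exact coeff_downLYM_sub_nonneg hK (show 2 ≤ j by omega) n

/-! ### The rows in real terms -/

section Interior

variable {q} (hq : ∀ i, 0 < (q i : ℝ) ∧ (q i : ℝ) < 1)
include hq

omit hq in
/-- `ev` of `Ñ₂`, expanded. [this work] -/
theorem ev_N2gen (KX KZ : Finset (Finset (Fin k))) : ev q (N2gen KX KZ) =
    ev q (ee 2) * (ev q PiP + ev q Dd) * (ev q PiP * ev q (gf (smallCommonFaces KX KZ)) - ev q (gf (smallFaces KX)) * ev q (gf (smallFaces KZ)))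
      - ev q Th * ev q PiP * ev q Dd * ev q (gf (commonEdges KX KZ))
      - ev q (ee 2) * ev q Dd * (ev q (gf (smallFaces KX)) * ev q (gf (bigFaces KZ)) + ev q (gf (bigFaces KX)) * ev q (gf (smallFaces KZ)))
      + ev q (ee 2) * ev q Th * ev q (gf (bigFaces KX)) * ev q (gf (bigFaces KZ)) := by
  unfold ev N2gen
  simp only [eval₂_add, eval₂_sub, eval₂_mul]

omit hq in
/-- `Π = Θ + D` at `r`. [this work] -/
theorem ev_PiP_eq : ev q (PiP : MvPolynomial (Fin k) ℤ) = ev q Th + ev q Dd := by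
  unfold ev; rw [PiP_eq_sizes, Th_eq, eval₂_add]

/-- **(TC) from `Ñ₂ ≥ 0`** at a pair of nonempty up-sets. [this work] -/
theorem tc_of_N2 (hk : 2 ≤ k) {𝒳 𝒵 : Set (Set (Fin k))} (hN : 0 ≤ ev q (N2gen (cx 𝒳) (cx 𝒵))) :
    pr q (allButTwo k) * (1 - pr q (allButTwo k)) * ∑ T, rho2 q T * ind (𝒳 ∩ 𝒵) T ≤ tcRHS q (allButTwo k) 𝒳 𝒵 := by
  have hW := W_pos hq
  have he2 := ev_ee_two_pos hq hk
  have hr0 : ∀ i, 0 ≤ r q i := r_nonneg hq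
  -- the dictionary
  have hθ : pr q (allButTwo k) = W q * ev q Th := by rw [pr_eq_ev hq, gf_cx_allButTwo]
  have hδ : 1 - pr q (allButTwo k) = W q * ev q Dd := by rw [← pr_compl, pr_eq_ev hq, gf_cx_compl]
  have hπ : pr q (exTwo k) = W q * ev q (ee 2) := by rw [pr_eq_ev hq, gf_cx_exTwo]
  have hPi := W_mul_ev_PiP hq
  have hPi' := ev_PiP_eq (q := q)
  have hY : pr q (exTwo k ∩ (𝒳 ∩ 𝒵)) = W q * ev q (gf (commonEdges (cx 𝒳) (cx 𝒵))) := by rw [pr_eq_ev hq, gf_cx_exTwo_inter₂]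
  have hHY : pr q (allButTwo k ∩ (𝒳 ∩ 𝒵)) = W q * ev q (gf (smallCommonFaces (cx 𝒳) (cx 𝒵))) := by rw [pr_eq_ev hq, gf_cx_allButTwo_inter₂]
  have hX : pr q 𝒳 = W q * (ev q (gf (smallFaces (cx 𝒳))) + ev q (gf (bigFaces (cx 𝒳)))) := by
    rw [pr_eq_ev hq, gf_cx_split]; unfold ev; rw [eval₂_add]
  have hZ : pr q 𝒵 = W q * (ev q (gf (smallFaces (cx 𝒵))) + ev q (gf (bigFaces (cx 𝒵)))) := by
    rw [pr_eq_ev hq, gf_cx_split]; unfold ev; rw [eval₂_add]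
  have htX : pr q ((allButTwo k)ᶜ ∩ 𝒳) = W q * ev q (gf (bigFaces (cx 𝒳))) := by rw [pr_eq_ev hq, gf_cx_compl_inter]
  have htZ : pr q ((allButTwo k)ᶜ ∩ 𝒵) = W q * ev q (gf (bigFaces (cx 𝒵))) := by rw [pr_eq_ev hq, gf_cx_compl_inter]
  have hin : pr q (𝒳 ∩ 𝒵) - pr q ((allButTwo k)ᶜ ∩ (𝒳 ∩ 𝒵)) = W q * ev q (gf (smallCommonFaces (cx 𝒳) (cx 𝒵))) := by
    rw [pr_compl_inter, ← hHY]; ring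
  rw [sum_rho2_ind, tcRHS, show (2 - pr q (allButTwo k)) * (pr q (𝒳 ∩ 𝒵) - pr q 𝒳 * pr q 𝒵 - pr q ((allButTwo k)ᶜ ∩ (𝒳 ∩ 𝒵))) =
    (2 - pr q (allButTwo k)) * ((pr q (𝒳 ∩ 𝒵) - pr q ((allButTwo k)ᶜ ∩ (𝒳 ∩ 𝒵))) - pr q 𝒳 * pr q 𝒵) by ring, hin,
    show (2 : ℝ) - pr q (allButTwo k) = 1 + (1 - pr q (allButTwo k)) by ring, hδ, hθ, hπ, hY, hX, hZ, htX, htZ]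
  rw [ev_N2gen] at hN
  -- abbreviate the real numbers
  set W' := W q
  set Pv := ev q (PiP : MvPolynomial (Fin k) ℤ)
  set Θv := ev q (Th : MvPolynomial (Fin k) ℤ)
  set Dv := ev q (Dd : MvPolynomial (Fin k) ℤ)
  set e2 := ev q (ee 2 : MvPolynomial (Fin k) ℤ)
  set hXv := ev q (gf (smallFaces (cx 𝒳)))
  set tXv := ev q (gf (bigFaces (cx 𝒳)))
  set hZv := ev q (gf (smallFaces (cx 𝒵)))
  set tZv := ev q (gf (bigFaces (cx 𝒵)))
  set hYv := ev q (gf (smallCommonFaces (cx 𝒳) (cx 𝒵)))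
  set eYv := ev q (gf (commonEdges (cx 𝒳) (cx 𝒵)))
  have hPpos : 0 < Pv := pos_of_mul_pos_right (by rw [hPi]; exact one_pos) hW.le
  have hWP : W' = 1 / Pv := by
    field_simp; linarith [hPi]
  rw [div_eq_mul_inv, hWP]
  rw [hPi'] at hN hPpos ⊢
  have hΘD : 0 < Θv + Dv := hPpos
  rw [← sub_nonneg]
  have key : (1 + 1 / (Θv + Dv) * Dv) * (1 / (Θv + Dv) * hYv - 1 / (Θv + Dv) * (hXv + tXv) * (1 / (Θv + Dv) * (hZv + tZv))) +
      1 / (Θv + Dv) * (hXv + tXv) * (1 / (Θv + Dv) * tZv) + 1 / (Θv + Dv) * (hZv + tZv) * (1 / (Θv + Dv) * tXv) -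
      1 / (Θv + Dv) * Θv * (1 / (Θv + Dv) * Dv) * (1 / (Θv + Dv) * eYv * (1 / (Θv + Dv) * e2)⁻¹) =
      (e2 * ((Θv + Dv) + Dv) * ((Θv + Dv) * hYv - hXv * hZv) - Θv * (Θv + Dv) * Dv * eYv
        - e2 * Dv * (hXv * tZv + tXv * hZv) + e2 * Θv * tXv * tZv) / (e2 * (Θv + Dv) ^ 3) := by
    field_simp
    ring
  rw [key]
  exact div_nonneg hN (by positivity)

/-- **(o) from weighted LYM** at an up-set. [this work] -/
theorem o_row (hk : 2 ≤ k) {𝒯 : Set (Set (Fin k))} (h𝒯 : IsUpperSet 𝒯) :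
    pr q ((allButTwo k)ᶜ ∩ 𝒯) ≤ (1 - pr q (allButTwo k)) * ∑ T, rho2 q T * ind 𝒯 T := by
  have hW := W_pos hq
  have he2 := ev_ee_two_pos hq hk
  have hr0 : ∀ i, 0 ≤ r q i := r_nonneg hq
  have hδ : 1 - pr q (allButTwo k) = W q * ev q Dd := by rw [← pr_compl, pr_eq_ev hq, gf_cx_compl]
  have hπ : pr q (exTwo k) = W q * ev q (ee 2) := by rw [pr_eq_ev hq, gf_cx_exTwo]
  have hE : pr q (exTwo k ∩ 𝒯) = W q * ev q (gf (commonEdges (cx 𝒯) (cx 𝒯))) := by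
    rw [pr_eq_ev hq, ← gf_cx_exTwo_inter₂, Set.inter_self]
  have ht : pr q ((allButTwo k)ᶜ ∩ 𝒯) = W q * ev q (gf (bigFaces (cx 𝒯))) := by rw [pr_eq_ev hq, gf_cx_compl_inter]
  have hlym : ev q (ee 2 * gf (bigFaces (cx 𝒯))) ≤ ev q (Dd * gf (commonEdges (cx 𝒯) (cx 𝒯))) := by
    have h := eval_le_of_coeff_le (P := (0 : MvPolynomial (Fin k) ℤ)) (Q := Dd * gf (commonEdges (cx 𝒯) (cx 𝒯)) - ee 2 * gf (bigFaces (cx 𝒯)))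
      (fun m => by rw [coeff_zero]; exact coeff_lymEdges_sub_nonneg (isLowerSet_cx h𝒯) m) (r q) hr0
    rw [eval₂_zero, eval₂_sub, sub_nonneg] at h
    exact h
  unfold ev at hlym
  rw [eval₂_mul, eval₂_mul] at hlym
  rw [sum_rho2_ind, ht, hδ, hπ, hE, mul_div_mul_left _ _ hW.ne']
  rw [show W q * ev q Dd * (ev q (gf (commonEdges (cx 𝒯) (cx 𝒯))) / ev q (ee 2)) =
    W q * (ev q Dd * ev q (gf (commonEdges (cx 𝒯) (cx 𝒯))) / ev q (ee 2)) by ring]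
  refine mul_le_mul_of_nonneg_left ?_ hW.le
  rw [le_div_iff₀ he2]
  unfold ev
  linarith [hlym]

/-- **THE ALL-BUT-TWO CERTIFICATE (conditional form).**  For `k ≥ 2` and interior parameters, if the capacity inequality (a)
`Θ(r)D(r) ≤ (Π(r)+D(r))e₂(r)` holds and `Ñ₂(K_𝒳,K_𝒵)(r) ≥ 0` for all nonempty up-sets `𝒳, 𝒵`, then `ρ₂` is a reduced transport certificate of
`allButTwo k`. [this work] -/
theorem rhoCert_allButTwo (hk : 2 ≤ k) (hA : ev q Th * ev q Dd ≤ (ev q PiP + ev q Dd) * ev q (ee 2 : MvPolynomial (Fin k) ℤ))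
    (hN : ∀ 𝒳 𝒵 : Set (Set (Fin k)), IsUpperSet 𝒳 → IsUpperSet 𝒵 → 𝒳.Nonempty → 𝒵.Nonempty → 0 ≤ ev q (N2gen (cx 𝒳) (cx 𝒵))) :
    RhoCert q (allButTwo k) (rho2 q) := by
  have hW := W_pos hq
  have he2 := ev_ee_two_pos hq hk
  have hθ : pr q (allButTwo k) = W q * ev q Th := by rw [pr_eq_ev hq, gf_cx_allButTwo]
  have hδ : 1 - pr q (allButTwo k) = W q * ev q Dd := by rw [← pr_compl, pr_eq_ev hq, gf_cx_compl]
  have hπ : pr q (exTwo k) = W q * ev q (ee 2) := by rw [pr_eq_ev hq, gf_cx_exTwo]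
  have hPi := W_mul_ev_PiP hq
  have hπpos : 0 < pr q (exTwo k) := by rw [hπ]; exact mul_pos hW he2
  have hθ1 : pr q (allButTwo k) ≤ 1 := pr_le_one q _
  refine ⟨fun T => ?_, fun T hT => ?_, ?_, fun T => ?_, fun 𝒯 h𝒯 => o_row hq hk h𝒯, fun 𝒳 𝒵 h𝒳 h𝒵 => ?_⟩
  · -- `ρ ≥ 0`
    unfold rho2; split_ifs
    · exact div_nonneg (bw_nonneg q T) hπpos.le
    · exact le_rfl
  · -- support
    unfold rho2; rw [if_neg fun h => hT (exTwo_subset h)]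
  · -- mass one
    have h := sum_rho2_ind q (Set.univ : Set (Set (Fin k)))
    simp only [Set.inter_univ] at h
    rw [div_self hπpos.ne'] at h
    rw [← h]
    exact sum_congr rfl fun T _ => by rw [ind_of_mem (Set.mem_univ T), mul_one]
  · -- (a) capacity
    unfold rho2
    split_ifs with hT
    · rw [mul_div_assoc']
      rw [div_le_iff₀ hπpos]
      have hb := bw_nonneg q T
      have key : pr q (allButTwo k) * (1 - pr q (allButTwo k)) ≤ (2 - pr q (allButTwo k)) * pr q (exTwo k) := by
        rw [show (2 : ℝ) - pr q (allButTwo k) = 1 + (1 - pr q (allButTwo k)) by ring, hδ, hθ, hπ, ← hPi]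
        have : W q * ev q Th * (W q * ev q Dd) = W q * W q * (ev q Th * ev q Dd) := by ring
        rw [this, show (W q * ev q PiP + W q * ev q Dd) * (W q * ev q (ee 2)) = W q * W q * ((ev q PiP + ev q Dd) * ev q (ee 2)) by ring]
        exact mul_le_mul_of_nonneg_left hA (mul_nonneg hW.le hW.le)
      nlinarith [key, hb]
    · rw [mul_zero]; exact mul_nonneg (by linarith) (bw_nonneg q T)
  · -- (TC)
    by_cases hne : 𝒳.Nonempty ∧ 𝒵.Nonempty
    · exact tc_of_N2 hq hk (hN 𝒳 𝒵 h𝒳 h𝒵 hne.1 hne.2)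
    · have h0 : 𝒳 ∩ 𝒵 = ∅ := by
        rw [not_and_or, Set.not_nonempty_iff_eq_empty, Set.not_nonempty_iff_eq_empty] at hne
        rcases hne with h | h
        · rw [h, Set.empty_inter]
        · rw [h, Set.inter_empty]
      have hL : ∑ T, rho2 q T * ind (𝒳 ∩ 𝒵) T = 0 := sum_eq_zero fun T _ => by rw [h0, ind_of_not_mem (Set.notMem_empty T), mul_zero]
      rw [hL, mul_zero, tcRHS, h0, Set.inter_empty, SahiTransportCert.pr_empty]
      rw [not_and_or, Set.not_nonempty_iff_eq_empty, Set.not_nonempty_iff_eq_empty] at hne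
      rcases hne with h | h
      · rw [h, SahiTransportCert.pr_empty, Set.inter_empty, SahiTransportCert.pr_empty]; ring_nf; rfl
      · rw [h, SahiTransportCert.pr_empty, Set.inter_empty, SahiTransportCert.pr_empty]; ring_nf; rfl

end Interior

/-- **KAHN'S CONJECTURE 5 / SAHI'S `C₃` FOR THE ALL-BUT-TWO FIRST SLOT, CONDITIONAL ON THE c = 2 CERTIFICATE POLYNOMIAL.**  For a block
`e : Fin k ↪ ι` (`k ≥ 2`) with interior parameters, an increasing event `H` determined by the block whose pattern event is `allButTwo k`, the two
polynomial hypotheses of `rhoCert_allButTwo` at the block odds, and ALL increasing `U, V`: `E₃(1_H, 1_U, 1_V) ≥ 0`. [this work] -/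
theorem sahiE_three_nonneg_of_allButTwo {ι : Type} [Fintype ι] (p : ι → unitInterval) (e : Fin k ↪ ι) (hk : 2 ≤ k)
    (hp : ∀ i, 0 < (p (e i) : ℝ) ∧ (p (e i) : ℝ) < 1)
    (hA : ev (pk e p) Th * ev (pk e p) Dd ≤ (ev (pk e p) PiP + ev (pk e p) Dd) * ev (pk e p) (ee 2 : MvPolynomial (Fin k) ℤ))
    (hN : ∀ 𝒳 𝒵 : Set (Set (Fin k)), IsUpperSet 𝒳 → IsUpperSet 𝒵 → 𝒳.Nonempty → 𝒵.Nonempty → 0 ≤ ev (pk e p) (N2gen (cx 𝒳) (cx 𝒵)))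
    {H : Set (Set ι)} (hH : DeterminedBy H (Set.range e)) (hpat : pat e H = allButTwo k) {U V : Set (Set ι)} (hU : IsUpperSet U) (hV : IsUpperSet V) :
    0 ≤ sahiE (bernoulliWeight p) 3 ![ind H, ind U, ind V] := by
  have hq : ∀ i, 0 < (pk e p i : ℝ) ∧ (pk e p i : ℝ) < 1 := hp
  have hc : RhoCert (pk e p) (pat e H) (rho2 (pk e p)) := by rw [hpat]; exact rhoCert_allButTwo hq hk hA hN
  exact sahiE_three_nonneg_of_rhoCert p e hH hc hU hV

end SahiAllButTwo

end Summit.CriticalPhenomena.PercolationContinuityZ3.Theorems
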